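import Mathlib.Analysis.InnerProductSpace.PiL2
import Mathlib.Analysis.Calculus.ContDiff.Defs
import Literature.Analysis.FluidPDE.MildSolutions
import Literature.Analysis.FluidPDE.NSWave0
import HarnessLib

/-!
# Named fact: a global Kato solution from a Clay datum is a Clay-class classical solution

Grounder file (D-0014 named facts) for the route `NavierStokesRegularity/MinimalBlowupRigidity`,
statement item stmt-NavierStokesRegularity-0108 (`minimalBlowupRigidity_kato_to_clay`), the
regularity half of the route's assembly.

In print (composite of standard theorems): let `ν > 0` and let `u₀ : ℝ³ → ℝ³` be smooth,
divergence free and rapidly decaying (Fefferman (4)), so `u₀ ∈ L² ∩ L³ ∩ H^∞`. If the (unique,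
Kato 1984 Thm. 2 / Furioli–Lemarié-Rieusset–Terraneo 2000) mild solution `u ∈ C([0, ∞); L³)`
with `u(0) = u₀` exists globally, then (i) `u` is `C^∞` on `ℝ³ × (0, ∞)` (parabolic smoothing of
Kato solutions: Kato, Math. Z. 187 (1984), Thm. 4; Lemarié-Rieusset 2002, Ch. 15, Prop. 15.1 and
Thm. 15.2), (ii) `u` coincides on its interval of existence with the local classical `H^∞`
solution from `u₀` (Majda–Bertozzi 2002 Thm. 3.4, uniqueness of mild `L³` solutions), so `u` and
the associated pressure `p = (−Δ)^{-1} ∂ᵢ∂ⱼ(uᵢuⱼ)` are jointly smooth up to `t = 0`, and (iii)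
`u ∈ L^∞(0, ∞; L²)` by the energy equality for these regular solutions (Lemarié-Rieusset 2002,
Ch. 27; `sup_t ‖u(t)‖₂ ≤ ‖u₀‖₂`). Hence `(u, p)` is a solution in the sense of Fefferman's (A):
smooth on `ℝ³ × [0, ∞)`, solving the equations with datum `u₀`, with bounded energy.

Nothing is asserted; users take `(h : Literature.NS.clay_solution_of_hasGlobalKatoSolution)`.

## References

* T. Kato, *Strong `L^p`-solutions of the Navier–Stokes equation in `ℝ^m`*, Math. Z. 187 (1984),
  471–480, Thms. 2, 4.
* P. G. Lemarié-Rieusset, *Recent developments in the Navier–Stokes problem*, CRC 2002, Ch. 15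
  (Prop. 15.1, Thm. 15.2), Ch. 27.
* H. Fujita, T. Kato, ARMA 16 (1964), Thm. 1.1.
* A. Majda, A. Bertozzi, *Vorticity and Incompressible Flow*, CUP 2002, Thm. 3.4.
-/

noncomputable section

namespace Literature.Analysis.FluidPDE

/-- NAMED FACT (global Kato solution from a Clay datum `⟹` Clay-class solution; Kato, Math. Z. 187
(1984), Thm. 4 (smoothing of `C_t L³` mild solutions) with Lemarié-Rieusset 2002, Ch. 15
(Prop. 15.1/Thm. 15.2: regularity and uniqueness of Kato solutions) and Ch. 27 (energy equality,
`L²` persistence), Majda–Bertozzi 2002 Thm. 3.4 for smoothness up to `t = 0` from `H^∞` data).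
For `ν > 0` and `u₀` smooth, divergence free and rapidly decaying with a global Kato solution
(`HasGlobalKatoSolution ν u₀`), there are jointly smooth `u`, `p` on `ℝ³ × [0, ∞)`
(`IsSmoothOnHalfSpace`) solving the Navier–Stokes system with datum `u₀`
(`IsNavierStokesSolution ν 0 u₀ u p`) and with bounded energy (`HasBoundedEnergy u`).
Users take `(h : clay_solution_of_hasGlobalKatoSolution)`. [cite: Kato1984, Thm. 4 (with LemarieRieusset2002 Ch. 15, 27)] -/
def clay_solution_of_hasGlobalKatoSolution : Prop :=
  ∀ ν : ℝ, 0 < ν → ∀ u₀ : EuclideanSpace ℝ (Fin 3) → EuclideanSpace ℝ (Fin 3),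
    ContDiff ℝ (⊤ : ℕ∞) u₀ → NSWave0.IsDivFree u₀ → HasRapidSpatialDecay u₀ → HasGlobalKatoSolution ν u₀ →
      ∃ (u : ℝ → EuclideanSpace ℝ (Fin 3) → EuclideanSpace ℝ (Fin 3))
        (p : ℝ → EuclideanSpace ℝ (Fin 3) → ℝ),
        IsSmoothOnHalfSpace u ∧ IsSmoothOnHalfSpace p ∧ IsNavierStokesSolution ν 0 u₀ u p ∧
          HasBoundedEnergy u

end Literature.Analysis.FluidPDE

end
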